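import Summits.BirchSwinnertonDyer.BirchSwinnertonDyer.Theorems.ThetaPartnerAtTwoSignedKatoUpToAtTwoKummerCharacter
import Summits.BirchSwinnertonDyer.BirchSwinnertonDyer.Theorems.ThetaPartnerAtTwoSignedControlAtTwoPlusLocalInjOfLift
import Summits.BirchSwinnertonDyer.BirchSwinnertonDyer.Theorems.ThetaPartnerAtTwoSignedControlAtTwoPlusCyclicOfHonda
import Literature.NumberTheory.EllipticCurves.Kobayashi2003.FineSelmerLeSignedSelmerProofs
import HarnessLib

/-!
# Route `ThetaPartnerAtTwo` (TP2), crux K3 `SignedKatoDivisibilityUpToAtTwo` (item stmt-BirchSwinnertonDyer-20308),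
# line `colemanrat` v3 — THE POINTS-MODEL `j : Hom(E^ε(K_∞·K_v), ℤ_p) → X^ε(E/K_∞)` ON THE PINNED DUAL: for any pinned
# `D : SignedSelmerDualData W κ γ ε` and a place `v ∋ p` there is an additive `j : Hom(⨆ₙ E^ε(K_n·K_v), ℤ_p) →+ D.X` whose
# character `D.toDual (j φ_A)` evaluates a class `s ∈ Sel^ε(E/K_∞)` to `φ_A(p^k Q)/p^k (mod 1)` for ANY Kummer witness `(Q, k)` of `s`
# at the chosen place above `v` (any number field `K`, prime `p`, `ℤ_p`-extension `κ`, sign `ε`, under «no `p`-torsion in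
# `E(K_∞·K_v)`»; UNCONDITIONAL at `p = 2` for `W/ℚ` globally minimal with `GoodSS W 2`).

Width seat `bsd-wall-tp2-p2x-w3` g2 (cell `bsd-wall`). HONEST FRAMING: THEOREMS ONLY — no definition, no named fact, no instance,
no `sorry`; route-independent; closes no item; BSD is NOT proved by any of this. `Λ`-linearity of `j` and the local cover are NOT here.

## What is proved

* §1 (tree: `Rank1Residual.Additive.signedLocalPointsOfEmb_mono` — `E^ε(K_n·K_v)` increase with `n`); `mem_iSup_signedLocalPointsOfEmb_iff`;
  `iSup_signedLocalPointsOfEmb_saturated` — `A^ε := ⨆ₙ E^ε(K_n·K_v)` is `p`-saturated in `E(K_∞·K_v)` under (NT) (K4 seat's layer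
  saturation `SignedEC.mem_signedLocalPointsOfEmb_of_nsmul_mem`).
* §2 `exists_pointsModelJ` — **the map `j`**: `∃ j : (A^ε →+ ℤ_p) →+ D.X`, `D.toDual (j φ_A) ⟨s, _⟩ = (φ_A(p^k Q) mod p^k) • (1/p^k)` for
  every `s ∈ Sel^ε(E/K_∞)` and every Kummer witness `(φ, Q, k)` of `s` relative to `A^ε` at the chosen place above `v`
  (`…KummerCharacter.exists_kummerPairing` + K4's `SignedEC.signedSelmerInfty_le_localKummerOverOfEmb_iSup_signedLocalPoints` + `D.bijective`).
* §2b `exists_torsion_kummerWitness_of_resOfLe_eq_zero`, `toDual_pointsModelJ_eq_zero_of_resOfLe_eq_zero` — `j` VANISHES on the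
  classes locally trivial at `𝔭` (torsion witness): `range j` lies in the characters killing `Sel^ε ∩ ker res_𝔭` (easy half of the
  local cover).
* §3 `exists_pointsModelJ_two` — `K = ℚ`, `p = 2`, `W` globally minimal, `GoodSS W 2`: the same with (NT) discharged
  (`SSFlatEC.eq_zero_of_mem_localTowerPointsOfEmb_of_two_nsmul`).

References: [Kobayashi2003] Def. 1.1, §2 p. 4, (7.17) (p. 12), (8.23) (p. 18); [Sprung2012] §1 p. 1486, Lemma 2.3; [GreenbergLNM1716] §2.
-/

set_option autoImplicit false
-- the Theorems namespace of this sub repeats the summit name by design (D-0017 nested layout)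
set_option linter.dupNamespace false

noncomputable section

open scoped Classical

namespace Summit.BirchSwinnertonDyer.BirchSwinnertonDyer.Theorems

namespace SignedKatoOffTwo.KummerPoint

open NumberField IsDedekindDomain Field WeierstrassCurve
  Literature.NumberTheory.EllipticCurves Literature.NumberTheory.EllipticCurves.Kobayashi2003
  Literature.NumberTheory.EllipticCurves.GreenbergSelmer
  Literature.NumberTheory.EllipticCurves.Sprung2012 Literature.NumberTheory.GaloisRepresentations ZpExtension
  Literature.NumberTheory.EllipticCurves.Rank1Residual Summit.BirchSwinnertonDyer.Rank1Residual.Additive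

universe u

/-! ## §1 `n ↦ E^ε(K_n·K_v)` is increasing; `⨆ₙ E^ε(K_n·K_v)` is saturated -/

section Mono

variable {K : Type u} [Field K] (W : WeierstrassCurve K) {p : ℕ} [Fact p.Prime] (κ : ZpExtension K p)
  {E : Type u} [Field E] [Algebra K E] (ι : AlgebraicClosure K →ₐ[K] AlgebraicClosure E)

/-- Membership in `⨆ₙ E^ε(K_n·K_v)` is membership in some layer (directed union). [folklore] -/
theorem mem_iSup_signedLocalPointsOfEmb_iff (ε : ℤˣ) (x : localPoints W E) :
    x ∈ (⨆ n, signedLocalPointsOfEmb κ ι W ε n) ↔ ∃ n, x ∈ signedLocalPointsOfEmb κ ι W ε n :=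
  AddSubgroup.mem_iSup_of_directed
    ((Summit.BirchSwinnertonDyer.Rank1Residual.Additive.signedLocalPointsOfEmb_mono (κ := κ) (ι := ι) (W := W) ε).directed_le)

/-- **`A^ε = ⨆ₙ E^ε(K_n·K_v)` is `p`-saturated in `E(K_∞·K_v)`** under (NT) «no `p`-torsion in `E(K_∞·K_v)`» (layerwise saturation,
K4 seat's `SignedEC.mem_signedLocalPointsOfEmb_of_nsmul_mem`). [cite: Kobayashi2003, §2 p. 4, Prop. 8.7] -/
theorem iSup_signedLocalPointsOfEmb_saturated (hnt : ∀ P ∈ localTowerPointsOfEmb κ ι W, p • P = 0 → P = 0) (ε : ℤˣ) :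
    ∀ y ∈ localTowerPointsOfEmb κ ι W, p • y ∈ (⨆ n, signedLocalPointsOfEmb κ ι W ε n) →
      y ∈ (⨆ n, signedLocalPointsOfEmb κ ι W ε n) := by
  intro y hy hpy
  obtain ⟨n, hn⟩ := (mem_iSup_signedLocalPointsOfEmb_iff W κ ι ε _).1 hpy
  exact (mem_iSup_signedLocalPointsOfEmb_iff W κ ι ε _).2
    ⟨n, SignedEC.mem_signedLocalPointsOfEmb_of_nsmul_mem W κ ι hnt ε n hy hn⟩

end Mono

/-! ## §2 The points-model `j` on a pinned dual -/

section J

variable {K : Type u} [Field K] [NumberField K] (W : WeierstrassCurve K) (p : ℕ) [Fact p.Prime]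
  (κ : ZpExtension K p) {γ : absoluteGaloisGroup K} (ε : ℤˣ)

/-- **The points-model `j : Hom(A^ε, ℤ_p) → X^ε` on the pinned dual.** Let `v ∋ p`, `A^ε := ⨆ₙ E^ε(K_n·K_v)` (signed points at the
chosen place above `v`), and assume (NT). For every pinned `D : SignedSelmerDualData W κ γ ε` there is an additive
`j : (A^ε →+ ℤ_p) →+ D.X` such that for every `φ_A`, every `s ∈ Sel^ε(E/K_∞)` and every Kummer witness `(φ, Q, k)` of `s` relative to
`A^ε`: `D.toDual (j φ_A) ⟨s, _⟩ = (φ_A(p^k Q) mod p^k) • (1/p^k)`. (`Sel^ε_∞ ≤ Kummer(A^ε)` at the chosen place is K4's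
`signedSelmerInfty_le_localKummerOverOfEmb_iSup_signedLocalPoints`; the pairing is `exists_kummerPairing`; `D.toDual` is bijective.)
[cite: Kobayashi2003, (7.17) (p. 12), (8.23) (p. 18)] [cite: Sprung2012, §1 p. 1486] -/
theorem exists_pointsModelJ (v : HeightOneSpectrum (𝓞 K)) (hv : (p : 𝓞 K) ∈ v.asIdeal)
    (hnt : ∀ P ∈ localTowerPointsOfEmb κ (closureEmb (K := K) (v.adicCompletion K)) W, p • P = 0 → P = 0)
    (D : SignedSelmerDualData W κ γ ε) :
    ∃ j : (↥(⨆ n, signedLocalPoints κ (v.adicCompletion K) W ε n) →+ ℤ_[p]) →+ D.X,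
      ∀ (φA : ↥(⨆ n, signedLocalPoints κ (v.adicCompletion K) W ε n) →+ ℤ_[p])
        (s : W.subgroupH1 p κ.kerSubgroup) (hs : s ∈ signedSelmerInfty W κ ε)
        (φ : contOneCocycles (discreteTopRep κ.kerSubgroup (W.geomPrimaryTorsion p)))
        (Q : localPoints W (v.adicCompletion K)) (k : ℕ)
        (_ : oneCocycleClass _ φ = s) (hQ : p ^ k • Q ∈ (⨆ n, signedLocalPoints κ (v.adicCompletion K) W ε n))
        (_ : ∀ τ : localSubgroupOfEmb κ.kerSubgroup (closureEmb (K := K) (v.adicCompletion K)),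
          pointsMapOfEmb W (closureEmb (K := K) (v.adicCompletion K))
              ((φ.1 (resGalSubgroupOfEmb κ.kerSubgroup _ τ) : W.geomPrimaryTorsion p) : W.geomPoints) =
            (τ : absoluteGaloisGroup (v.adicCompletion K)) • Q - Q),
        D.toDual (j φA) ⟨s, hs⟩ =
          (PadicInt.toZModPow k (φA ⟨p ^ k • Q, hQ⟩)).val • ((((p : ℚ) ^ k)⁻¹ : ℚ) : AddCircle (1 : ℚ)) := by
  set ι := closureEmb (K := K) (v.adicCompletion K) with hι
  set A : AddSubgroup (localPoints W (v.adicCompletion K)) := ⨆ n, signedLocalPoints κ (v.adicCompletion K) W ε n with hA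
  have hsat : ∀ y ∈ localTowerPointsOfEmb κ ι W, p • y ∈ A → y ∈ A := iSup_signedLocalPointsOfEmb_saturated W κ ι hnt ε
  have hle : signedSelmerInfty W κ ε ≤ localKummerOverOfEmb W p κ.kerSubgroup ι A :=
    SignedEC.signedSelmerInfty_le_localKummerOverOfEmb_iSup_signedLocalPoints W κ ε v hv
  obtain ⟨J, hJ⟩ := exists_kummerPairing W p κ ι A hsat
  set eD := AddEquiv.ofBijective D.toDual D.bijective with heD
  have heD_apply : ∀ χ, D.toDual (eD.symm χ) = χ := fun χ ↦ eD.apply_symm_apply χ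
  refine ⟨{ toFun := fun φA ↦ eD.symm ((J φA).comp (AddSubgroup.inclusion hle))
            map_zero' := by rw [map_zero, AddMonoidHom.zero_comp, map_zero]
            map_add' := fun φA ψA ↦ by rw [map_add, AddMonoidHom.add_comp, map_add] },
    fun φA s hs φ Q k hφ hQ hτ ↦ ?_⟩
  show D.toDual (eD.symm ((J φA).comp (AddSubgroup.inclusion hle))) ⟨s, hs⟩ = _
  rw [heD_apply, AddMonoidHom.comp_apply]
  exact hJ φA (AddSubgroup.inclusion hle ⟨s, hs⟩) φ Q k hφ hQ hτ

/-- **A class locally trivial at `𝔭` has a TORSION Kummer witness**: if `res_{Gal(K̄/K_∞) ⊓ D_v} s = 0` then `s = [φ]` with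
`ι(φ τ) = τ•ι(t) − ι(t)` on `Gal(K̄_v/K_∞·K_v)` for some `t ∈ E[p^∞](K̄)`; with `p^m t = 0` the triple `(φ, ι t, m)` is a Kummer
witness relative to ANY `A` (`p^m • ι t = 0 ∈ A`). [cite: Kobayashi2003, §2 p. 4] [cite: SerreGaloisCohomology1997, I §5.1] -/
theorem exists_torsion_kummerWitness_of_resOfLe_eq_zero (v : HeightOneSpectrum (𝓞 K))
    (A : AddSubgroup (localPoints W (v.adicCompletion K)))
    (φ : contOneCocycles (discreteTopRep κ.kerSubgroup (W.geomPrimaryTorsion p)))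
    (h0 : Literature.NumberTheory.EllipticCurves.resOfLe (W.geomPrimaryTorsion p)
      (inf_le_left : κ.kerSubgroup ⊓ decomp v ≤ κ.kerSubgroup) (oneCocycleClass _ φ) = 0) :
    ∃ (t : W.geomPrimaryTorsion p) (m : ℕ),
      p ^ m • pointsMapOfEmb W (closureEmb (K := K) (v.adicCompletion K)) (t : W.geomPoints) ∈ A ∧
      p ^ m • pointsMapOfEmb W (closureEmb (K := K) (v.adicCompletion K)) (t : W.geomPoints) = 0 ∧
      ∀ τ : localSubgroupOfEmb κ.kerSubgroup (closureEmb (K := K) (v.adicCompletion K)),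
        pointsMapOfEmb W (closureEmb (K := K) (v.adicCompletion K))
            ((φ.1 (resGalSubgroupOfEmb κ.kerSubgroup _ τ) : W.geomPrimaryTorsion p) : W.geomPoints) =
          (τ : absoluteGaloisGroup (v.adicCompletion K)) •
              pointsMapOfEmb W (closureEmb (K := K) (v.adicCompletion K)) (t : W.geomPoints) -
            pointsMapOfEmb W (closureEmb (K := K) (v.adicCompletion K)) (t : W.geomPoints) := by
  obtain ⟨t, ht⟩ := exists_principal_of_resOfLe_eq_zero W p inf_le_left φ h0
  obtain ⟨m, hm⟩ : ∃ m : ℕ, p ^ m • (t : W.geomPoints) = 0 := AddCommGroup.mem_primaryComponent.mp t.2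
  have h0' : p ^ m • pointsMapOfEmb W (closureEmb (K := K) (v.adicCompletion K)) (t : W.geomPoints) = 0 := by
    rw [← map_nsmul, hm, map_zero]
  refine ⟨t, m, by rw [h0']; exact zero_mem A, h0', fun τ ↦ ?_⟩
  have hτ : resGalOfEmb (closureEmb (K := K) (v.adicCompletion K)) (τ : absoluteGaloisGroup (v.adicCompletion K)) ∈
      κ.kerSubgroup ⊓ decomp v :=
    Subgroup.mem_inf.2 ⟨τ.2, resGalOfEmb_mem_decomp v _⟩
  have h1 := ht _ τ.2 hτ
  have h1' : (φ.1 (resGalSubgroupOfEmb κ.kerSubgroup _ τ) : W.geomPrimaryTorsion p) =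
      resGalOfEmb (closureEmb (K := K) (v.adicCompletion K)) (τ : absoluteGaloisGroup (v.adicCompletion K)) • t - t := h1
  rw [h1', AddSubgroupClass.coe_sub, map_sub, primaryComponent.coe_smul, pointsMapOfEmb_smul]

/-- **The points-model `j` VANISHES on the classes locally trivial at `𝔭`**: for every `j` with the value formula of `exists_pointsModelJ`
(any witness), `D.toDual (j φ_A) ⟨s, _⟩ = 0` whenever `res_{Gal(K̄/K_∞) ⊓ D_v} s = 0` — the torsion witness gives the value
`φ_A(0)/p^m = 0`. So `range j ⊆ {x | D.toDual x vanishes on Sel^ε ∩ ker res_𝔭}`, the EASY inclusion of the local cover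
(`…FineStrictRat`, `…OffTwoLocalPackageRat`). [cite: Kobayashi2003, §2 p. 4, (7.17) (p. 12)] -/
theorem toDual_pointsModelJ_eq_zero_of_resOfLe_eq_zero (v : HeightOneSpectrum (𝓞 K)) (D : SignedSelmerDualData W κ γ ε)
    (j : (↥(⨆ n, signedLocalPoints κ (v.adicCompletion K) W ε n) →+ ℤ_[p]) →+ D.X)
    (hj : ∀ (φA : ↥(⨆ n, signedLocalPoints κ (v.adicCompletion K) W ε n) →+ ℤ_[p])
        (s : W.subgroupH1 p κ.kerSubgroup) (hs : s ∈ signedSelmerInfty W κ ε)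
        (φ : contOneCocycles (discreteTopRep κ.kerSubgroup (W.geomPrimaryTorsion p)))
        (Q : localPoints W (v.adicCompletion K)) (k : ℕ)
        (_ : oneCocycleClass _ φ = s) (hQ : p ^ k • Q ∈ (⨆ n, signedLocalPoints κ (v.adicCompletion K) W ε n))
        (_ : ∀ τ : localSubgroupOfEmb κ.kerSubgroup (closureEmb (K := K) (v.adicCompletion K)),
          pointsMapOfEmb W (closureEmb (K := K) (v.adicCompletion K))
              ((φ.1 (resGalSubgroupOfEmb κ.kerSubgroup _ τ) : W.geomPrimaryTorsion p) : W.geomPoints) =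
            (τ : absoluteGaloisGroup (v.adicCompletion K)) • Q - Q),
        D.toDual (j φA) ⟨s, hs⟩ =
          (PadicInt.toZModPow k (φA ⟨p ^ k • Q, hQ⟩)).val • ((((p : ℚ) ^ k)⁻¹ : ℚ) : AddCircle (1 : ℚ)))
    (φA : ↥(⨆ n, signedLocalPoints κ (v.adicCompletion K) W ε n) →+ ℤ_[p])
    {s : W.subgroupH1 p κ.kerSubgroup} (hs : s ∈ signedSelmerInfty W κ ε)
    (hres : Literature.NumberTheory.EllipticCurves.resOfLe (W.geomPrimaryTorsion p)
      (inf_le_left : κ.kerSubgroup ⊓ decomp v ≤ κ.kerSubgroup) s = 0) :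
    D.toDual (j φA) ⟨s, hs⟩ = 0 := by
  obtain ⟨φ, rfl⟩ := oneCocycleClass_surjective _ s
  obtain ⟨t, m, htA, ht0, hτ⟩ :=
    exists_torsion_kummerWitness_of_resOfLe_eq_zero W p κ v (⨆ n, signedLocalPoints κ (v.adicCompletion K) W ε n) φ hres
  rw [hj φA _ hs φ _ m rfl htA hτ]
  have : (⟨p ^ m • pointsMapOfEmb W (closureEmb (K := K) (v.adicCompletion K)) (t : W.geomPoints), htA⟩ :
      ↥(⨆ n, signedLocalPoints κ (v.adicCompletion K) W ε n)) = 0 := Subtype.ext ht0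
  rw [this, map_zero, val_smul_invPow_zero]

end J

/-! ## §3 `p = 2` on the habitat: (NT) discharged -/

section Two

variable (W : WeierstrassCurve ℚ) [W.IsElliptic] [W.IsGloballyMinimal] (κ : ZpExtension ℚ 2) {γ : absoluteGaloisGroup ℚ} (ε : ℤˣ)

/-- **The points-model `j` at `p = 2`, unconditionally on K3's habitat** (`W/ℚ` globally minimal, `GoodSS W 2`, any `ℤ₂`-extension `κ`,
any sign, any pinned `D`): (NT) is the `bsd-2adic` cell's `SSFlatEC.eq_zero_of_mem_localTowerPointsOfEmb_of_two_nsmul`.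
[cite: Kobayashi2003, (7.17) (p. 12)] [cite: Sprung2012, Lemma 2.3 (p. 1487)] -/
theorem exists_pointsModelJ_two (hss : GoodSS W 2) (v : HeightOneSpectrum (𝓞 ℚ)) (hv : (2 : 𝓞 ℚ) ∈ v.asIdeal)
    (D : SignedSelmerDualData W κ γ ε) :
    ∃ j : (↥(⨆ n, signedLocalPoints κ (v.adicCompletion ℚ) W ε n) →+ ℤ_[2]) →+ D.X,
      ∀ (φA : ↥(⨆ n, signedLocalPoints κ (v.adicCompletion ℚ) W ε n) →+ ℤ_[2])
        (s : W.subgroupH1 2 κ.kerSubgroup) (hs : s ∈ signedSelmerInfty W κ ε)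
        (φ : contOneCocycles (discreteTopRep κ.kerSubgroup (W.geomPrimaryTorsion 2)))
        (Q : localPoints W (v.adicCompletion ℚ)) (k : ℕ)
        (_ : oneCocycleClass _ φ = s) (hQ : 2 ^ k • Q ∈ (⨆ n, signedLocalPoints κ (v.adicCompletion ℚ) W ε n))
        (_ : ∀ τ : localSubgroupOfEmb κ.kerSubgroup (closureEmb (K := ℚ) (v.adicCompletion ℚ)),
          pointsMapOfEmb W (closureEmb (K := ℚ) (v.adicCompletion ℚ))
              ((φ.1 (resGalSubgroupOfEmb κ.kerSubgroup _ τ) : W.geomPrimaryTorsion 2) : W.geomPoints) =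
            (τ : absoluteGaloisGroup (v.adicCompletion ℚ)) • Q - Q),
        D.toDual (j φA) ⟨s, hs⟩ =
          (PadicInt.toZModPow k (φA ⟨2 ^ k • Q, hQ⟩)).val • ((((2 : ℚ) ^ k)⁻¹ : ℚ) : AddCircle (1 : ℚ)) := by
  have hnt : ∀ P ∈ localTowerPointsOfEmb κ (closureEmb (K := ℚ) (v.adicCompletion ℚ)) W, 2 • P = 0 → P = 0 :=
    fun P hP h2 ↦ SSFlatEC.eq_zero_of_mem_localTowerPointsOfEmb_of_two_nsmul W hss κ hv _ hP h2
  have h := exists_pointsModelJ W 2 κ ε v (by exact_mod_cast hv) hnt D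
  simpa using h

end Two

end SignedKatoOffTwo.KummerPoint

end Summit.BirchSwinnertonDyer.BirchSwinnertonDyer.Theorems

end
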